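import Summits.PneNP.PneNP.Theorems.SymmetryBudgetWindowCanoniserLevelsReplay

/-!
# Window canoniser, VI′: children live in lower level blocks

Route `PneNP/SymmetryBudget`, dichotomy `WindowBarrier` (stmt-PneNP-2145) / `NoHiddenOrder` (stmt-PneNP-14781);
continuation of `…WindowCanoniserLevelsReplay.lean`.  Children of a label (candidates, parts) have smaller
measure, hence all their atoms live below every atom of the label; levels of the child-reading formers
(`nonbotF`, `lbitA`, `pvecA`, `leafBitW`).  Used by `…LevelsMain.lean`.
-/

-- `Summit.PneNP.PneNP.…` duplicates `PneNP` BY DESIGN (single-problem summit, D-0017 layout).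
set_option linter.dupNamespace false

noncomputable section

namespace Summit.PneNP.PneNP.Theorems

namespace WCan

open Finset Equiv Literature.Computability.Complexity

variable {K r n : ℕ} [NeZero n]

/-! ### Children live below -/

section Child

variable (L : Lab K n)

omit [NeZero n] in
/-- A fresh admissible candidate has smaller measure. -/
theorem M_candLab_lt {x : Fin n} {h : Fin (n + 1)} {Lc : Lab K n} (hc : candLab L x h = some Lc) : Lc.1.M < L.1.M := by
  unfold candLab at hc
  split_ifs at hc with hx
  cases hc
  exact RawLab.M_cand_lt _ hx.1 _

omit [NeZero n] in
/-- A proper part has smaller measure. -/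
theorem M_partLab_lt {U' : Finset (Fin n)} {Lc : Lab K n} (hc : partLab L U' = some Lc) : Lc.1.M < L.1.M := by
  unfold partLab at hc
  split_ifs at hc with hU
  cases hc
  exact RawLab.M_part_lt _ hU.1

omit [NeZero n] in
/-- A child has smaller measure. -/
theorem M_chLab_lt {P : Prm r n} {Lc : Lab K n} (hc : chLab L P = some Lc) : Lc.1.M < L.1.M := by
  unfold chLab at hc
  split_ifs at hc
  · exact M_partLab_lt L hc
  · exact M_candLab_lt L hc

omit [NeZero n] in
/-- The block of a label of smaller measure ends below mine. -/
theorem lb_add_BLK_le {Lc L : Lab K n} (hM : Lc.1.M < L.1.M) : lb Lc + BLK n ≤ lb L := by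
  simp only [lb]
  have := Nat.mul_le_mul_right (BLK n) hM
  rw [Nat.succ_mul] at this
  omega

omit [NeZero n] in
/-- A main atom of a child is below any level of mine. -/
theorem child_main_lt {Lc L : Lab K n} (hM : Lc.1.M < L.1.M) (e : ℕ) (he : e < 12) (X : ℕ) :
    lb Lc + ((T n + 1) * RS n + e) < lb L + X := by
  have h := lb_add_BLK_le hM
  simp only [BLK, MS] at h ⊢
  omega

omit [NeZero n] in
/-- A main atom of a child at offset `0` is below any level of mine. -/
theorem child_main_lt0 {Lc L : Lab K n} (hM : Lc.1.M < L.1.M) (X : ℕ) : lb Lc + (T n + 1) * RS n < lb L + X := by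
  simpa using child_main_lt hM 0 (by norm_num) X

omit [NeZero n] in
/-- A replay atom of a child is below any level of mine. -/
theorem child_replay_lt {Lc L : Lab K n} (hM : Lc.1.M < L.1.M) (it : Fin (T n + 1)) {e : ℕ} (he : e < RS n) (X : ℕ) :
    lb Lc + (it * RS n + e) < lb L + X := by
  have h := lb_add_BLK_le hM
  have h1 : (it : ℕ) * RS n ≤ T n * RS n := Nat.mul_le_mul_right _ (Nat.lt_succ_iff.1 it.2)
  have h2 : T n * RS n + RS n = (T n + 1) * RS n := by ring
  simp only [BLK, MS] at h
  omega

omit [NeZero n] in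
/-- A state atom of a child is below any level of mine. -/
theorem child_replay_lt0 {Lc L : Lab K n} (hM : Lc.1.M < L.1.M) (it : Fin (T n + 1)) (X : ℕ) :
    lb Lc + it * RS n < lb L + X := by
  have := child_replay_lt hM it (e := 0) (by simp [RS]) X
  simpa using this

omit [NeZero n] in
/-- `T n * RS n < (T n + 1) * RS n + X`: the final state is below the main computation. -/
theorem T_RS_lt (X : ℕ) : T n * RS n < (T n + 1) * RS n + X := by
  have : (T n + 1) * RS n = T n * RS n + RS n := Nat.succ_mul _ _
  simp [RS] at this ⊢; omega

/-- `n1ok_rkF`: bookkeeping/simp lemma (n1ok rkF). -/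
theorem n1ok_rkF {c : ℕ} (Lx : Lab K n) (w j : Fin n) (h : lb Lx + (T n + 1) * RS n < c) : N1ok c (rkF (r := r) Lx w j) :=
  n1ok_n1and (by simp; omega) (by omega)

/-- `n1ok_EQF`: bookkeeping/simp lemma (n1ok EQF). -/
theorem n1ok_EQF {c : ℕ} (Lx : Lab K n) (a b : Fin n) (h : lb Lx + T n * RS n < c) : N1ok c (EQF (r := r) Lx a b) :=
  n1ok_n1and (by simp [Fin.val_last]; omega) (by omega)

/-- `ok_nonbotF`: bookkeeping/simp lemma (ok nonbotF). -/
theorem ok_nonbotF {c : ℕ} (Lc : Lab K n) (z : Fin n) (h : lb Lc + ((T n + 1) * RS n + 4) < c) : OK c (w2 (nonbotF (r := r) Lc z)) := by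
  unfold nonbotF
  have hRS : RS n = 4 * n + 8 := rfl
  have hmul : (T n + 1) * RS n = T n * RS n + RS n := Nat.succ_mul _ _
  split_ifs
  · exact ok_w2_n2and (by simp) (by omega)
  · refine ok_w2_n2or ?_ (by omega)
    simp only [List.mem_cons, List.not_mem_nil, or_false, forall_eq_or_imp, forall_eq]
    refine ⟨n1ok_n1and ?_ (by omega), n1ok_n1and ?_ (by omega)⟩ <;>
      simp only [List.mem_cons, List.not_mem_nil, or_false, forall_eq_or_imp, forall_eq, al_aConn, al_aInonbot,
        al_aPnonbot, Fin.val_last] <;> omega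

/-- The lifted value bit is read at local level `≤ 1`. -/
theorem al_lbitA_lt (κ : Fin n × Fin (n + 1)) (i : Fin (NB r n)) (X : ℕ) (hX : 2 ≤ X) :
    (lbitA L κ i).al < lb L + ((T n + 1) * RS n + X) := by
  unfold lbitA
  split
  · simp; omega
  · split
    · rename_i Lc hc
      have := child_main_lt (M_candLab_lt L hc) 11 (by norm_num) ((T n + 1) * RS n + X)
      simpa using this
    · simp [SH]

/-- The part-vector bit is read at local level `≤ 3`. -/
theorem al_pvecA_lt (u : Fin n) (i : Fin (NBp r n)) (X : ℕ) (hX : 4 ≤ X) :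
    (pvecA L u i).al < lb L + ((T n + 1) * RS n + X) := by
  unfold pvecA
  split
  · simp; omega
  · split <;> simp <;> omega

/-- The static leaf bits are read at level `≤ 1`. -/
theorem ok_leafBitW {c : ℕ} (i : Fin (NB r n)) (hc : 1 < c) : OK c (leafBitW L i) := by
  unfold leafBitW
  split_ifs
  · dsimp only
    split
    · exact ok_wA (by simp; omega)
    · split_ifs
      · exact ok_wA (by simp [hc])
      · exact ok_wA (by simp; omega)
    · split_ifs
      · exact ok_wA (by simp; omega)
      · exact ok_wA (by simp; omega)
  · exact ok_wA (by simp; omega)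

end Child

end WCan

end Summit.PneNP.PneNP.Theorems

end
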